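import Mathlib
import Literature.MathematicalPhysics.StatisticalMechanics.BarlowStacking
import HarnessLib

/-!
# The covering radius of a Barlow stacking, layer by layer

Topic `Literature/MathematicalPhysics/StatisticalMechanics`; companion of `BarlowStacking.lean`
(`barlowPos a h s k i j`, `barlowLayer a h s k`, `barlowStacking a h s`: close-packed triangular layers of
spacing `a` in the planes `x₃ = k h`, lateral letters coded by the Hägg word `s`), which defers "the
covering radius" to this file.

* `exists_barlowPos_inPlane_dist_sq_le` — **covering radius of one close-packed layer**: every point of
  the plane is within HORIZONTAL squared distance `a²/3` of layer `k` (the deep holes of the hexagonal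
  lattice `A₂` are the triangle centroids, `R = 2ρ/√3 = a/√3`), for every `k` and every word `s`;
* `exists_mem_barlowLayer_dist_sq_le` — hence within squared distance `a²/3 + (x₃ − k h)²` of layer `k`;
* `exists_mem_barlowBilayer_dist_sq_le` — **bilayer covering**: a point between the planes of layers
  `k`, `k + 1` is within squared distance `a²/3 + h²/4` of a site OF THESE TWO LAYERS (use the nearer
  plane); for the ideal spacing `h² = 2a²/3` this is `a²/2`, the squared octahedral-hole radius, so the
  bound is sharp for Hägg words;
* `exists_mem_barlowStacking_dist_sq_le` — **every Barlow stacking has covering radius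
  `≤ √(a²/3 + h²/4)`** (`= a/√2 = ρ√2` in the ideal case: Conway–Sloane give `R = ρ√2` for the fcc and
  the hcp; the bilayer argument gives it for every stacking, Hägg or not);
* slab and one-sided forms with LAYER CONTROL — `exists_barlowPos_slab_dist_sq_le` (a point whose
  height lies in `[k h, m h]` is close to a site of the layers `k, …, m` themselves),
  `exists_barlowPos_above_dist_sq_le` (height `≥ k h` ⇒ a close site in the layers `≥ k`), and the
  strict sub-layer form `exists_mem_barlowLayer_dist_sq_lt` (height strictly within `h` of the plane of
  layer `k` ⇒ a site of layer `k` at squared distance `< a²/3 + h²`, `= a²` ideally);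
* the tree's ideal frame `a = 1`, `h = √(2/3)` (unit balls): `exists_barlowPos_slab_dist_sq_le_half`,
  `exists_barlowPos_above_dist_sq_le_half`, `exists_barlowPos_dist_lt_one_of_sq_lt`, and the
  **sealing consequences for `1`-separated sets** containing complete layers of a MOVED stacking
  `A·B(s) + t`: `eq_movedBarlowPos_of_slab_complete` (a point whose frame height lies in the complete
  slab `[k h, m h]` IS a site of the slab — no loss at the two boundary planes) and
  `eq_movedBarlowPos_of_layer_complete` (a point strictly within frame height `h` of a complete layer
  is a site of that layer).

[cite: ConwaySloane1999, Ch. 4 §6.2 (hexagonal lattice: `R = 2ρ/√3`, deep holes `(±1/2, ±1/(2√3))`),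
§6.3 (fcc: covering radius `R = ρ√2`, deep = octahedral holes), §6.5 (hcp: `R = ρ√2 = 1/√2`, octahedral
holes `(0, 1/√3, 1/√6)`)]; the layer-by-layer statements are the same computation organised by height
[folklore].  Consumed by the wall ledgers of `Summits/Ventures/Crystal3D` (route StickyWulffConstant:
slab sealing / floor cleanliness of `TwoSlabAdhesion`, frame tables of the Barlow tent).
-/

noncomputable section

open Set

namespace Literature.MathematicalPhysics.StatisticalMechanics

/-! ## The hexagonal form on the unit cell -/

/-- For `x, y ≥ 0`, `x + y ≤ 1` (the lower triangle `0, u, v` of the cell of the triangular lattice, in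
lattice coordinates) one of the three vertices is within squared hexagonal distance `1/3`
(`q(X, Y) = X² + XY + Y² = ‖X u + Y v‖²/a²`): the barycentric identity
`(1−x−y) q(x,y) + x q(x−1,y) + y q(x,y−1) = 1/3 − q(x−⅓, y−⅓)`. [cite: ConwaySloane1999, Ch. 4 §6.2] -/
private theorem hexForm_triangle_cover {x y : ℝ} (hx : 0 ≤ x) (hy : 0 ≤ y) (hxy : x + y ≤ 1) :
    x ^ 2 + x * y + y ^ 2 ≤ 1 / 3 ∨ (x - 1) ^ 2 + (x - 1) * y + y ^ 2 ≤ 1 / 3 ∨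
      x ^ 2 + x * (y - 1) + (y - 1) ^ 2 ≤ 1 / 3 := by
  by_contra hcon
  simp only [not_or, not_le] at hcon
  obtain ⟨h₀, h₁, h₂⟩ := hcon
  have hid : (1 - x - y) * (x ^ 2 + x * y + y ^ 2) + x * ((x - 1) ^ 2 + (x - 1) * y + y ^ 2) +
      y * (x ^ 2 + x * (y - 1) + (y - 1) ^ 2) =
      1 / 3 - ((x - 1 / 3) ^ 2 + (x - 1 / 3) * (y - 1 / 3) + (y - 1 / 3) ^ 2) := by ring
  have hq : 0 ≤ (x - 1 / 3) ^ 2 + (x - 1 / 3) * (y - 1 / 3) + (y - 1 / 3) ^ 2 := by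
    nlinarith [sq_nonneg (x - 1 / 3 + (y - 1 / 3) / 2), sq_nonneg (y - 1 / 3)]
  nlinarith [mul_le_mul_of_nonneg_left h₀.le (by linarith : (0 : ℝ) ≤ 1 - x - y),
    mul_le_mul_of_nonneg_left h₁.le hx, mul_le_mul_of_nonneg_left h₂.le hy]

/-- In the unit cell `0 ≤ x, y ≤ 1` of the triangular lattice some cell vertex `(δ, ε) ∈ ℤ²` is within
squared hexagonal distance `1/3` (lower triangle: `hexForm_triangle_cover`; upper triangle: the same for
`(1 − x, 1 − y)`). [cite: ConwaySloane1999, Ch. 4 §6.2] -/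
private theorem hexForm_cell_cover {x y : ℝ} (hx0 : 0 ≤ x) (hx1 : x ≤ 1) (hy0 : 0 ≤ y) (hy1 : y ≤ 1) :
    ∃ δ ε : ℤ, (x - δ) ^ 2 + (x - δ) * (y - ε) + (y - ε) ^ 2 ≤ 1 / 3 := by
  by_cases hxy : x + y ≤ 1
  · rcases hexForm_triangle_cover hx0 hy0 hxy with h | h | h
    · exact ⟨0, 0, by push_cast; nlinarith [h]⟩
    · exact ⟨1, 0, by push_cast; nlinarith [h]⟩
    · exact ⟨0, 1, by push_cast; nlinarith [h]⟩
  · push Not at hxy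
    rcases hexForm_triangle_cover (x := 1 - x) (y := 1 - y) (by linarith) (by linarith) (by linarith)
      with h | h | h
    · exact ⟨1, 1, by push_cast; nlinarith [h]⟩
    · exact ⟨0, 1, by push_cast; nlinarith [h]⟩
    · exact ⟨1, 0, by push_cast; nlinarith [h]⟩

/-! ## One layer -/

/-- **Covering radius of a close-packed layer.**  For every layer `k` of every stacking and every point
`q`, some site of layer `k` is within HORIZONTAL squared distance `a²/3` of `q` (`a ≠ 0`; the layer is
the triangular lattice of spacing `|a|` shifted by `(haggLabel s k)·w`, whose deep holes — the triangle
centroids — are at distance `|a|/√3`). [cite: ConwaySloane1999, Ch. 4 §6.2 (`R = 2ρ/√3`)] -/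
theorem exists_barlowPos_inPlane_dist_sq_le {a : ℝ} (ha : a ≠ 0) (h : ℝ) (s : ℤ → ℤ) (k : ℤ)
    (q : EuclideanSpace ℝ (Fin 3)) :
    ∃ i j : ℤ, (q 0 - barlowPos a h s k i j 0) ^ 2 + (q 1 - barlowPos a h s k i j 1) ^ 2 ≤
      a ^ 2 / 3 := by
  obtain ⟨L, hL⟩ : ∃ L : ℝ, ((haggLabel s k : ℤ) : ℝ) = L := ⟨_, rfl⟩
  have h3 : Real.sqrt 3 ≠ 0 := by positivity
  have h3sq : Real.sqrt 3 ^ 2 = 3 := Real.sq_sqrt (by norm_num)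
  -- lattice coordinates of `q`: `q = a (α u + β v + L w)` in the plane
  obtain ⟨β, hq1⟩ : ∃ β : ℝ, q 1 = a * Real.sqrt 3 / 2 * (β + L / 3) := by
    refine ⟨q 1 / (a * Real.sqrt 3 / 2) - L / 3, ?_⟩
    field_simp
    ring
  obtain ⟨α, hq0⟩ : ∃ α : ℝ, q 0 = a * (α + β / 2 + L / 2) := by
    refine ⟨q 0 / a - β / 2 - L / 2, ?_⟩
    field_simp
    ring
  have key : ∀ i j : ℤ, (q 0 - barlowPos a h s k i j 0) ^ 2 + (q 1 - barlowPos a h s k i j 1) ^ 2 =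
      a ^ 2 * ((α - i) ^ 2 + (α - i) * (β - j) + (β - j) ^ 2) := by
    intro i j
    rw [barlowPos_apply_zero, barlowPos_apply_one, hL, hq0, hq1]
    linear_combination (a ^ 2 / 4 * (β - j) ^ 2) * h3sq
  obtain ⟨δ, ε, hδε⟩ := hexForm_cell_cover (x := α - ⌊α⌋) (y := β - ⌊β⌋)
    (by linarith [Int.floor_le α]) (by linarith [Int.lt_floor_add_one α])
    (by linarith [Int.floor_le β]) (by linarith [Int.lt_floor_add_one β])
  refine ⟨⌊α⌋ + δ, ⌊β⌋ + ε, ?_⟩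
  rw [key]
  push_cast
  have e : (α - ((⌊α⌋ : ℝ) + δ)) ^ 2 + (α - (⌊α⌋ + δ)) * (β - ((⌊β⌋ : ℝ) + ε)) + (β - (⌊β⌋ + ε)) ^ 2 =
      (α - ⌊α⌋ - δ) ^ 2 + (α - ⌊α⌋ - δ) * (β - ⌊β⌋ - ε) + (β - ⌊β⌋ - ε) ^ 2 := by ring
  rw [e]
  nlinarith [mul_le_mul_of_nonneg_left hδε (sq_nonneg a)]

/-- The squared distance in `ℝ³` split into its horizontal and vertical parts. [folklore] -/
private theorem dist_sq_eq_inPlane_add (q z : EuclideanSpace ℝ (Fin 3)) :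
    dist q z ^ 2 = (q 0 - z 0) ^ 2 + (q 1 - z 1) ^ 2 + (q 2 - z 2) ^ 2 := by
  rw [EuclideanSpace.dist_eq, Real.sq_sqrt (Finset.sum_nonneg fun _ _ => sq_nonneg _),
    Fin.sum_univ_three, Real.dist_eq, Real.dist_eq, Real.dist_eq, sq_abs, sq_abs, sq_abs]

/-- **Distance to layer `k`.**  Every point `q` is within squared distance `a²/3 + (q₃ − k h)²` of some
site of layer `k` (any `k`, any word, any `h`). [cite: ConwaySloane1999, Ch. 4 §6.2] -/
theorem exists_mem_barlowLayer_dist_sq_le {a : ℝ} (ha : a ≠ 0) (h : ℝ) (s : ℤ → ℤ) (k : ℤ)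
    (q : EuclideanSpace ℝ (Fin 3)) :
    ∃ z ∈ barlowLayer a h s k, dist q z ^ 2 ≤ a ^ 2 / 3 + (q 2 - k * h) ^ 2 := by
  obtain ⟨i, j, hij⟩ := exists_barlowPos_inPlane_dist_sq_le ha h s k q
  refine ⟨barlowPos a h s k i j, ⟨i, j, rfl⟩, ?_⟩
  rw [dist_sq_eq_inPlane_add, barlowPos_apply_two]
  linarith

/-- **Strict sub-layer form.**  A point strictly within vertical distance `|h|` of the plane of layer `k`
has a site of layer `k` at squared distance `< a²/3 + h²` (`= a²` for the ideal spacing `h² = 2a²/3`: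
three balls around a hole leave room for a fourth only at vertical offset exactly `h`).
[cite: ConwaySloane1999, Ch. 4 §6.2 (`R = 2ρ/√3`)] [cite: HalesDSP2012, §1.3 (pp. 12–13: no room for
further balls)] -/
theorem exists_mem_barlowLayer_dist_sq_lt {a : ℝ} (ha : a ≠ 0) (h : ℝ) (s : ℤ → ℤ) (k : ℤ)
    (q : EuclideanSpace ℝ (Fin 3)) (hq : (q 2 - k * h) ^ 2 < h ^ 2) :
    ∃ z ∈ barlowLayer a h s k, dist q z ^ 2 < a ^ 2 / 3 + h ^ 2 := by
  obtain ⟨z, hz, hd⟩ := exists_mem_barlowLayer_dist_sq_le ha h s k q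
  exact ⟨z, hz, by linarith⟩

/-! ## Two layers, the stacking, slabs -/

/-- **Bilayer covering.**  A point between the planes of layers `k` and `k + 1` (`0 < h`) is within
squared distance `a²/3 + h²/4` of a site of one of THESE TWO layers (the nearer plane is at vertical
distance `≤ h/2`).  For `h² = 2a²/3` the bound `a²/2` is attained at the octahedral holes.
[cite: ConwaySloane1999, Ch. 4 §6.3 and §6.5 (octahedral = deep holes, `R = ρ√2`)] -/
theorem exists_mem_barlowBilayer_dist_sq_le {a : ℝ} (ha : a ≠ 0) {h : ℝ} (hh : 0 < h) (s : ℤ → ℤ)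
    (k : ℤ) (q : EuclideanSpace ℝ (Fin 3)) (hk : k * h ≤ q 2) (hk₁ : q 2 ≤ (k + 1) * h) :
    ∃ z ∈ barlowLayer a h s k ∪ barlowLayer a h s (k + 1), dist q z ^ 2 ≤ a ^ 2 / 3 + h ^ 2 / 4 := by
  by_cases hmid : q 2 - k * h ≤ h / 2
  · obtain ⟨z, hz, hd⟩ := exists_mem_barlowLayer_dist_sq_le ha h s k q
    refine ⟨z, Or.inl hz, hd.trans ?_⟩
    nlinarith
  · push Not at hmid
    obtain ⟨z, hz, hd⟩ := exists_mem_barlowLayer_dist_sq_le ha h s (k + 1) q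
    refine ⟨z, Or.inr hz, hd.trans ?_⟩
    push_cast
    nlinarith

/-- **Covering radius of a Barlow stacking.**  Every point of `ℝ³` is within squared distance
`a²/3 + h²/4` of `barlowStacking a h s` (`a ≠ 0`, `0 < h`, any word `s`); for the ideal spacing
`h² = 2a²/3` this is `a²/2 = (ρ√2)²`, the common covering radius of the fcc and the hcp — and, by the
bilayer argument, of every close-packed stacking. [cite: ConwaySloane1999, Ch. 4 §6.3 (fcc `R = ρ√2`),
§6.5 (hcp `R = ρ√2 = 1/√2`)] -/
theorem exists_mem_barlowStacking_dist_sq_le {a : ℝ} (ha : a ≠ 0) {h : ℝ} (hh : 0 < h) (s : ℤ → ℤ)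
    (q : EuclideanSpace ℝ (Fin 3)) :
    ∃ z ∈ barlowStacking a h s, dist q z ^ 2 ≤ a ^ 2 / 3 + h ^ 2 / 4 := by
  obtain ⟨k, hk_def⟩ : ∃ k : ℤ, k = ⌊q 2 / h⌋ := ⟨_, rfl⟩
  have hk : (k : ℝ) * h ≤ q 2 := by
    have := Int.floor_le (q 2 / h)
    rw [le_div_iff₀ hh, ← hk_def] at this
    exact this
  have hk₁ : q 2 ≤ (k + 1) * h := by
    have := Int.lt_floor_add_one (q 2 / h)
    rw [div_lt_iff₀ hh, ← hk_def] at this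
    exact this.le
  obtain ⟨z, hz, hd⟩ := exists_mem_barlowBilayer_dist_sq_le ha hh s k q hk hk₁
  refine ⟨z, ?_, hd⟩
  rcases hz with ⟨i, j, rfl⟩ | ⟨i, j, rfl⟩ <;> exact barlowPos_mem _ _ _

/-- **Slab form, with layer control.**  If the height of `q` lies in `[k h, m h]` (`k ≤ m`, `0 < h`), some
site of the layers `k, …, m` THEMSELVES is within squared distance `a²/3 + h²/4` of `q` (no loss at the
two boundary planes of the slab): the covering radius organised by height.
[cite: ConwaySloane1999, Ch. 4 §6.3, §6.5 (`R = ρ√2`, octahedral holes)] -/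
theorem exists_barlowPos_slab_dist_sq_le {a : ℝ} (ha : a ≠ 0) {h : ℝ} (hh : 0 < h) (s : ℤ → ℤ)
    {k m : ℤ} (hkm : k ≤ m) (q : EuclideanSpace ℝ (Fin 3)) (hk : k * h ≤ q 2) (hm : q 2 ≤ m * h) :
    ∃ k' i j : ℤ, k ≤ k' ∧ k' ≤ m ∧ dist q (barlowPos a h s k' i j) ^ 2 ≤ a ^ 2 / 3 + h ^ 2 / 4 := by
  by_cases htop : q 2 < m * h
  · -- the bilayer `⌊q₃/h⌋, ⌊q₃/h⌋ + 1` lies inside the slab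
    obtain ⟨k₀, hk₀_def⟩ : ∃ k₀ : ℤ, k₀ = ⌊q 2 / h⌋ := ⟨_, rfl⟩
    have hk₀ : (k₀ : ℝ) * h ≤ q 2 := by
      have := Int.floor_le (q 2 / h)
      rw [le_div_iff₀ hh, ← hk₀_def] at this
      exact this
    have hk₀₁ : q 2 ≤ (k₀ + 1) * h := by
      have := Int.lt_floor_add_one (q 2 / h)
      rw [div_lt_iff₀ hh, ← hk₀_def] at this
      exact this.le
    have hkk₀ : k ≤ k₀ := by
      rw [hk₀_def, Int.le_floor, le_div_iff₀ hh]; exact hk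
    have hk₀m : k₀ + 1 ≤ m := by
      have : k₀ < m := by
        have h1 : (k₀ : ℝ) * h < m * h := lt_of_le_of_lt hk₀ htop
        exact_mod_cast lt_of_mul_lt_mul_right h1 hh.le
      omega
    obtain ⟨z, hz, hd⟩ := exists_mem_barlowBilayer_dist_sq_le ha hh s k₀ q hk₀ hk₀₁
    rcases hz with ⟨i, j, rfl⟩ | ⟨i, j, rfl⟩
    · exact ⟨k₀, i, j, hkk₀, by omega, hd⟩
    · exact ⟨k₀ + 1, i, j, by omega, hk₀m, hd⟩
  · -- `q` lies in the top plane: layer `m` itself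
    push Not at htop
    have heq : q 2 = m * h := le_antisymm hm htop
    obtain ⟨z, ⟨i, j, rfl⟩, hd⟩ := exists_mem_barlowLayer_dist_sq_le ha h s m q
    refine ⟨m, i, j, hkm, le_rfl, hd.trans ?_⟩
    rw [heq, sub_self]
    nlinarith [sq_nonneg h]

/-- **One-sided form.**  If the height of `q` is `≥ k h` (`0 < h`), some site of the layers `≥ k` is
within squared distance `a²/3 + h²/4` of `q`. [cite: ConwaySloane1999, Ch. 4 §6.3, §6.5 (`R = ρ√2`)] -/
theorem exists_barlowPos_above_dist_sq_le {a : ℝ} (ha : a ≠ 0) {h : ℝ} (hh : 0 < h) (s : ℤ → ℤ)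
    (k : ℤ) (q : EuclideanSpace ℝ (Fin 3)) (hk : k * h ≤ q 2) :
    ∃ k' i j : ℤ, k ≤ k' ∧ dist q (barlowPos a h s k' i j) ^ 2 ≤ a ^ 2 / 3 + h ^ 2 / 4 := by
  obtain ⟨k₀, hk₀_def⟩ : ∃ k₀ : ℤ, k₀ = ⌊q 2 / h⌋ := ⟨_, rfl⟩
  have hk₀ : (k₀ : ℝ) * h ≤ q 2 := by
    have := Int.floor_le (q 2 / h)
    rw [le_div_iff₀ hh, ← hk₀_def] at this
    exact this
  have hk₀₁ : q 2 ≤ (k₀ + 1) * h := by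
    have := Int.lt_floor_add_one (q 2 / h)
    rw [div_lt_iff₀ hh, ← hk₀_def] at this
    exact this.le
  have hkk₀ : k ≤ k₀ := by
    rw [hk₀_def, Int.le_floor, le_div_iff₀ hh]; exact hk
  obtain ⟨z, hz, hd⟩ := exists_mem_barlowBilayer_dist_sq_le ha hh s k₀ q hk₀ hk₀₁
  rcases hz with ⟨i, j, rfl⟩ | ⟨i, j, rfl⟩
  · exact ⟨k₀, i, j, hkk₀, hd⟩
  · exact ⟨k₀ + 1, i, j, by omega, hd⟩

/-! ## The ideal frame `a = 1`, `h = √(2/3)` (unit balls) -/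

/-- `√(2/3)² = 2/3` and `0 < √(2/3)` (private plumbing). [folklore] -/
private theorem sqrt_two_thirds_facts : Real.sqrt (2 / 3) ^ 2 = 2 / 3 ∧ 0 < Real.sqrt (2 / 3) :=
  ⟨Real.sq_sqrt (by norm_num), Real.sqrt_pos.2 (by norm_num)⟩

/-- **Ideal slab form**: unit balls (`a = 1`, `h = √(2/3)`), height of `q` in `[k h, m h]` ⇒ a site of
the layers `k, …, m` with `dist² ≤ 1/2` (`dist ≤ 1/√2 < 1`).
[cite: ConwaySloane1999, Ch. 4 §6.5 (`R = ρ√2 = 1/√2`)] -/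
theorem exists_barlowPos_slab_dist_sq_le_half (s : ℤ → ℤ) {k m : ℤ} (hkm : k ≤ m)
    (q : EuclideanSpace ℝ (Fin 3)) (hk : k * Real.sqrt (2 / 3) ≤ q 2)
    (hm : q 2 ≤ m * Real.sqrt (2 / 3)) :
    ∃ k' i j : ℤ, k ≤ k' ∧ k' ≤ m ∧
      dist q (barlowPos 1 (Real.sqrt (2 / 3)) s k' i j) ^ 2 ≤ 1 / 2 := by
  obtain ⟨hsq, hpos⟩ := sqrt_two_thirds_facts
  have hval : (1 : ℝ) ^ 2 / 3 + Real.sqrt (2 / 3) ^ 2 / 4 = 1 / 2 := by rw [hsq]; norm_num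
  obtain ⟨k', i, j, h1, h2, hd⟩ := exists_barlowPos_slab_dist_sq_le one_ne_zero hpos s hkm q hk hm
  exact ⟨k', i, j, h1, h2, by rwa [hval] at hd⟩

/-- **Ideal one-sided form**: height of `q` at least `k √(2/3)` ⇒ a site of the layers `≥ k` with
`dist² ≤ 1/2`. [cite: ConwaySloane1999, Ch. 4 §6.5] -/
theorem exists_barlowPos_above_dist_sq_le_half (s : ℤ → ℤ) (k : ℤ) (q : EuclideanSpace ℝ (Fin 3))
    (hk : k * Real.sqrt (2 / 3) ≤ q 2) :
    ∃ k' i j : ℤ, k ≤ k' ∧ dist q (barlowPos 1 (Real.sqrt (2 / 3)) s k' i j) ^ 2 ≤ 1 / 2 := by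
  obtain ⟨hsq, hpos⟩ := sqrt_two_thirds_facts
  have hval : (1 : ℝ) ^ 2 / 3 + Real.sqrt (2 / 3) ^ 2 / 4 = 1 / 2 := by rw [hsq]; norm_num
  obtain ⟨k', i, j, h1, hd⟩ := exists_barlowPos_above_dist_sq_le one_ne_zero hpos s k q hk
  exact ⟨k', i, j, h1, by rwa [hval] at hd⟩

/-- **Ideal sub-layer form**: a point strictly within vertical distance `√(2/3)` of the plane of layer
`k` is at distance `< 1` from a site of layer `k`. [cite: ConwaySloane1999, Ch. 4 §6.2 (`R = 2ρ/√3`)]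
[cite: HalesDSP2012, §1.3 (pp. 12–13)] -/
theorem exists_barlowPos_dist_lt_one_of_sq_lt (s : ℤ → ℤ) (k : ℤ) (q : EuclideanSpace ℝ (Fin 3))
    (hq : (q 2 - k * Real.sqrt (2 / 3)) ^ 2 < 2 / 3) :
    ∃ i j : ℤ, dist q (barlowPos 1 (Real.sqrt (2 / 3)) s k i j) < 1 := by
  obtain ⟨hsq, -⟩ := sqrt_two_thirds_facts
  obtain ⟨z, ⟨i, j, rfl⟩, hd⟩ :=
    exists_mem_barlowLayer_dist_sq_lt one_ne_zero (Real.sqrt (2 / 3)) s k q (by rwa [hsq])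
  refine ⟨i, j, ?_⟩
  rw [hsq] at hd
  nlinarith [dist_nonneg (x := q) (y := barlowPos 1 (Real.sqrt (2 / 3)) s k i j)]

/-! ## Sealing: complete layers of a moved stacking inside a `1`-separated set -/

/-- Distances to a moved site: `dist q (A p + t) = dist (A⁻¹ (q − t)) p` (private plumbing). [folklore] -/
private theorem dist_moved_eq (A : EuclideanSpace ℝ (Fin 3) ≃ₗᵢ[ℝ] EuclideanSpace ℝ (Fin 3))
    (t q p : EuclideanSpace ℝ (Fin 3)) : dist q (A p + t) = dist (A.symm (q - t)) p := by
  have e : dist (A.symm (q - t)) p = dist (q - t) (A p) := by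
    conv_lhs => rw [show p = A.symm (A p) by simp]
    exact A.symm.dist_map _ _
  rw [e, dist_eq_norm, dist_eq_norm]
  congr 1
  abel

/-- **Slab sealing without boundary loss.**  Let `X` be `1`-separated and contain every site
`A p + t` of the layers `k, …, m` of the moved ideal stacking `A·(barlowStacking 1 √(2/3) s) + t`
(`k ≤ m`).  Then every point of `X` whose frame height `(A⁻¹(q − t))₃` lies in `[k√(2/3), m√(2/3)]` IS
one of those sites: the slab is sealed up to and including its two boundary planes (Hales's "no room
for further balls", localised to a slab of complete layers). [cite: HalesDSP2012, §1.3 (pp. 12–13)]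
[cite: ConwaySloane1999, Ch. 4 §6.5 (`R = ρ√2 = 1/√2`)] -/
theorem eq_movedBarlowPos_of_slab_complete (s : ℤ → ℤ)
    (A : EuclideanSpace ℝ (Fin 3) ≃ₗᵢ[ℝ] EuclideanSpace ℝ (Fin 3)) (t : EuclideanSpace ℝ (Fin 3))
    {X : Set (EuclideanSpace ℝ (Fin 3))} (hsep : ∀ x ∈ X, ∀ y ∈ X, x ≠ y → 1 ≤ dist x y)
    {k m : ℤ} (hkm : k ≤ m)
    (hcomplete : ∀ k' i j : ℤ, k ≤ k' → k' ≤ m →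
      A (barlowPos 1 (Real.sqrt (2 / 3)) s k' i j) + t ∈ X)
    {q : EuclideanSpace ℝ (Fin 3)} (hq : q ∈ X) (hk : k * Real.sqrt (2 / 3) ≤ (A.symm (q - t)) 2)
    (hm : (A.symm (q - t)) 2 ≤ m * Real.sqrt (2 / 3)) :
    ∃ k' i j : ℤ, k ≤ k' ∧ k' ≤ m ∧ q = A (barlowPos 1 (Real.sqrt (2 / 3)) s k' i j) + t := by
  obtain ⟨k', i, j, h1, h2, hd⟩ :=
    exists_barlowPos_slab_dist_sq_le_half s hkm (A.symm (q - t)) hk hm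
  refine ⟨k', i, j, h1, h2, ?_⟩
  by_contra hne
  have h1le := hsep q hq _ (hcomplete k' i j h1 h2) hne
  rw [dist_moved_eq] at h1le
  nlinarith [dist_nonneg (x := A.symm (q - t)) (y := barlowPos 1 (Real.sqrt (2 / 3)) s k' i j)]

/-- **Layer sealing.**  Let `X` be `1`-separated and contain every site `A p + t` of layer `k` of the
moved ideal stacking.  Then every point of `X` whose frame height is STRICTLY within `√(2/3)` of the
plane of layer `k` is a site of layer `k`: in the plane of a complete layer `X` has only that layer's
sites, and strictly between that plane and the two neighbouring layer planes `X` has no point at all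
(below a complete floor layer as well as above it). [cite: HalesDSP2012, §1.3 (pp. 12–13: no room for
further balls)] [cite: ConwaySloane1999, Ch. 4 §6.2] -/
theorem eq_movedBarlowPos_of_layer_complete (s : ℤ → ℤ)
    (A : EuclideanSpace ℝ (Fin 3) ≃ₗᵢ[ℝ] EuclideanSpace ℝ (Fin 3)) (t : EuclideanSpace ℝ (Fin 3))
    {X : Set (EuclideanSpace ℝ (Fin 3))} (hsep : ∀ x ∈ X, ∀ y ∈ X, x ≠ y → 1 ≤ dist x y) (k : ℤ)
    (hcomplete : ∀ i j : ℤ, A (barlowPos 1 (Real.sqrt (2 / 3)) s k i j) + t ∈ X)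
    {q : EuclideanSpace ℝ (Fin 3)} (hq : q ∈ X)
    (hlt : ((A.symm (q - t)) 2 - k * Real.sqrt (2 / 3)) ^ 2 < 2 / 3) :
    ∃ i j : ℤ, q = A (barlowPos 1 (Real.sqrt (2 / 3)) s k i j) + t := by
  obtain ⟨i, j, hd⟩ := exists_barlowPos_dist_lt_one_of_sq_lt s k (A.symm (q - t)) hlt
  refine ⟨i, j, ?_⟩
  by_contra hne
  have h1le := hsep q hq _ (hcomplete i j) hne
  rw [dist_moved_eq] at h1le
  linarith

end Literature.MathematicalPhysics.StatisticalMechanics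

end
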